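import Mathlib.Algebra.Group.Subgroup.Lattice
import Mathlib.Algebra.Group.Submonoid.Pointwise
import Mathlib.Algebra.Module.Defs
import Mathlib.RingTheory.Coprime.Basic
import Mathlib.Algebra.Group.Int.Even
import Mathlib.Tactic
import HarnessLib

/-!
# The COUPLED Cassels–Tate telescope, XXI: the (T-L3) KERNEL FORM — the `𝒪/4^κ` bookkeeping as a
# GENERIC-WITNESS brick (planner D668 (O1))

Crux `UpperOffV0HSYPlus` (stmt-BirchSwinnertonDyer-19804); rows' display RESIDUE c v3
(`…TailFourOfResidue` p714972 / `…TailSevenOfResidue` p714989), clause (T-L3) (the MIXED Čebotarev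
clause, memo Cor. 3.2″), whose conclusion at a Kolyvagin prime `ℓ` is the KERNEL FORM
`∀ g ∈ closure (insert g_X (insert (w g_X) (T_X ∪ w '' T_X))), (∀ v ∋ ℓ, g ∈ Ker v) ↔ g ∈ closure (T_X ∪ w '' T_X)`
for `w = w_S := H¹(fn_X)` (`w² + w + 1 = 0`) on `S := H¹(K, X_K[4^κ])` and `Ker v := torsionLocalKer`.

THIS file proves that kernel form for ANY abelian group `S` killed by a power of `2`, any `w : S →+ S`
with `w (w x) + w x + x = 0`, any `w`-stable family of subgroups `Ker i` (`P i`) containing `T`, from ONE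
scalar hypothesis on ONE element (`hone`: every `2^j • g` that is locally trivial lies in the small
closure) — and reduces `hone` to ONE pivot element (`forall_pow_smul_mem_of_pivot`).  The arithmetic
behind it is that `2` is inert in `ℤ[ω]`: for `a, b` not both even, `N = a² − ab + b²` is odd and
`(a − b)•y − b•w y = N•g` for `y = a•g + b•w g`, so `y` locally trivial forces `g` locally trivial.

* `map_mem_closure_union_image` — `closure (T ∪ w '' T)` is `w`-stable;
* `pair_smul_mem_closure_of_mem` — the induction on `|a| + |b|` (halving / odd norm);
* ★ `kernelForm_closure_pair_iff` — the display's kernel form, byte-shaped (`ι := HeightOneSpectrum (𝓞 K)`,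
  `P v := (ℓ : 𝓞 K) ∈ v.asIdeal`, `Ker v := torsionLocalKer (v.adicCompletion K) n`, `T := ↑T_X`);
* `forall_pow_smul_mem_of_pivot` — `hone` from the order-exponent `i` of `g` modulo the small closure and
  the non-local-triviality of the pivot `2^(i−1) • g`.

ROWS' ONE CALL per curve `X ∈ {A, B}` at the display's currency (certified: HOME
`g28/KernelForm.onecall.scratch.lean`, ONE `example` whose conclusion is RESIDUE 4 v3 l.177–182 verbatim):
`kernelForm_closure_pair_iff (resH1Hom (ContinuousMonoidHom.id _) fnX hfnX) hwX (2 ^ κ * 2 ^ κ) (κ + κ)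
(zsmul_galH1Torsion_eq_zero _ _) (dvd_of_eq (pow_add 2 κ κ).symm) (fun v : HeightOneSpectrum (𝓞 K) ↦
(ℓ : 𝓞 K) ∈ v.asIdeal) (fun v ↦ (X_K).torsionLocalKer (v.adicCompletion K) n) hKerX _ hTX gX
(forall_pow_smul_mem_of_pivot _ _ _ gX iX hiX hpivX)` — the set argument `T` MUST be passed as `_` (it is
then unified from the display's own `↑T_X ∪ ⇑w '' ↑T_X`; re-elaborating that text as an explicit argument
makes the defeq check between the `galH1Torsion`- and `discreteH1`-presentations of `H¹` run away,
> 6·10⁶ heartbeats — measured).  Side inputs, all tree one-liners: `hwX : ∀ c, w (w c) + w c + c = 0` :=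
`resH1Hom_id_apply_apply_add _ fnX hfnX hrelnX` (`hrelnX` from the pinned formula, k-ty1 #37
`JZero.torsion_hrel_of_formula`); `hKerX` := k-ty1 #35 `resH1Hom_id_mem_torsionLocalKer_of_hasLocalPointsMaps`
(its `hcoe` = the display's pinning clause); `hTX` = «`T_X` locally trivial at every `v ∋ ℓ`»; `iX, hiX, hpivX`
= the pivot data (order-exponent of `g_X` modulo the small closure, the pivot NOT locally trivial).

WHAT THEN REMAINS of (T-L3) for the rows (their currency, NOT claimed here) = (T-L3)‴ PAIR-ČEBOTAREV WITH
PIVOTS: one Kolyvagin prime `ℓ > b` at which `T_A`, `T_B` are locally trivial and the two pivots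
`2^(i_A−1) • g_A`, `2^(i_B−1) • g_B` are not (SPEC-K-TY v18.16 (R1)–(R5),
`exists_kolyvaginPrime_gt_of_galoisElement_pair … (M := 2κ)`); its Galois input «pivot ∉ Sm(T) ⇒ one `ρ`
killing `T`'s cocycles but not the pivots', jointly for both curves» is a SECOND typed gap at level `2^M`
(k-ty1 ON-CALL NOTE 3: the tree's joint-values theorems are prime-level only; proposed ★ KD²
`JZero.exists_h1Eval_pair_two_pow`) — flagged, not claimed.
Theorem-only (no definition, no named fact); pure algebra (Mathlib only);
nothing asserted on 19804; no stub closed; X12.CMAtTwo NOT proved; BSD not claimed for any curve.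
Sources: Kolyvagin 1990 (Euler systems) §4; McCallum 1991 §5 Thm 5.4; Gross 1991 §§3–5;
MEMO-bsd-cm-two §59.2 / Cor. 3.2″.
-/

-- every Summits module is named `Summit.<Summit>.<Problem>…`: the duplicated component is by design
set_option linter.dupNamespace false
set_option autoImplicit false

namespace Summit.BirchSwinnertonDyer.BirchSwinnertonDyer.Theorems.SylvesterTwoCoupledTelescope

section KernelForm

variable {S : Type*} [AddCommGroup S] (w : S →+ S)

/-- **The small closure `closure (T ∪ w '' T)` is `w`-stable** when `w (w x) + w x + x = 0`
(`w (w t) = −w t − t`). [folklore] -/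
theorem map_mem_closure_union_image (hw : ∀ x, w (w x) + w x + x = 0) (T : Set S) {x : S}
    (hx : x ∈ AddSubgroup.closure (T ∪ w '' T)) : w x ∈ AddSubgroup.closure (T ∪ w '' T) := by
  refine AddSubgroup.closure_induction (fun y hy ↦ ?_) ?_ (fun y z _ _ hy hz ↦ ?_) (fun y _ hy ↦ ?_) hx
  · rcases hy with hy | ⟨t, ht, rfl⟩
    · exact AddSubgroup.subset_closure (Or.inr ⟨y, hy, rfl⟩)
    · have h1 : w (w t) = -(w t) - t := by
        have h := hw t
        rw [add_assoc, add_eq_zero_iff_eq_neg] at h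
        rw [h, neg_add']
      rw [h1]
      exact sub_mem (neg_mem (AddSubgroup.subset_closure (Or.inr ⟨t, ht, rfl⟩)))
        (AddSubgroup.subset_closure (Or.inl ht))
  · rw [map_zero]; exact zero_mem _
  · rw [map_add]; exact add_mem hy hz
  · rw [map_neg]; exact neg_mem hy

/-- **The odd-norm identity**: `(a − b) • y + (−b) • w y = (a² − ab + b²) • g` for `y = a • g + b • w g`
when `w (w g) + w g + g = 0` (multiplication by the conjugate `(a − b) − b ω` in `ℤ[ω]`). [folklore] -/
theorem conj_smul_pair_eq (hw : ∀ x, w (w x) + w x + x = 0) (g : S) (a b : ℤ) :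
    (a - b) • (a • g + b • w g) + (-b) • w (a • g + b • w g) = (a * a - a * b + b * b) • g := by
  have h1 : w (w g) = -(w g) - g := by
    have h := hw g
    rw [add_assoc, add_eq_zero_iff_eq_neg] at h
    rw [h, neg_add']
  simp only [map_add, map_zsmul, h1]
  module

/-- **The induction behind the kernel form** (on `|a| + |b|`, generalising `g`): if every locally
trivial `2^j • g` lies in the small closure, then every locally trivial `a • g + b • w g` does —
halve when `a, b` are both even (pass to `2 • g`); otherwise `N = a² − ab + b²` is odd, `N • g` is
locally trivial (`conj_smul_pair_eq`), hence so is `g` (`u N + v 2^m = 1`, `2^m` kills `S` — given as `N • S = 0`, `N ∣ 2^m`), hence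
`g`, `w g` and `a • g + b • w g` lie in the small closure. [folklore] -/
theorem pair_smul_mem_closure_of_mem (hw : ∀ x, w (w x) + w x + x = 0) (N m : ℕ)
    (hN : ∀ x : S, (N : ℤ) • x = 0) (hNm : N ∣ 2 ^ m) (L : AddSubgroup S) (hL : ∀ x ∈ L, w x ∈ L)
    (T : Set S) :
    ∀ (n : ℕ) (g : S), (∀ j : ℕ, ((2 : ℤ) ^ j) • g ∈ L →
        ((2 : ℤ) ^ j) • g ∈ AddSubgroup.closure (T ∪ w '' T)) →
      ∀ a b : ℤ, a.natAbs + b.natAbs ≤ n → a • g + b • w g ∈ L →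
        a • g + b • w g ∈ AddSubgroup.closure (T ∪ w '' T) := by
  have hM' : ∀ x : S, ((2 : ℤ) ^ m) • x = 0 := fun x ↦ by
    obtain ⟨c, hc⟩ := hNm
    rw [show ((2 : ℤ) ^ m) = (c : ℤ) * (N : ℤ) by exact_mod_cast (mul_comm (N : ℕ) c ▸ hc :),
      mul_smul, hN, smul_zero]
  intro n
  induction n with
  | zero =>
    intro g _ a b hab _
    have ha : a = 0 := Int.natAbs_eq_zero.mp (by omega)
    have hb : b = 0 := Int.natAbs_eq_zero.mp (by omega)
    subst ha; subst hb
    simp only [zero_smul, add_zero]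
    exact zero_mem _
  | succ n ih =>
    intro g hone a b hab hy
    by_cases h2 : 2 ∣ a ∧ 2 ∣ b
    · -- both even: halve, passing to `2 • g`
      obtain ⟨⟨a₁, rfl⟩, ⟨b₁, rfl⟩⟩ := h2
      by_cases h0 : a₁ = 0 ∧ b₁ = 0
      · obtain ⟨rfl, rfl⟩ := h0
        simp only [mul_zero, zero_smul, add_zero]
        exact zero_mem _
      have he : (2 * a₁) • g + (2 * b₁) • w g = a₁ • ((2 : ℤ) • g) + b₁ • w ((2 : ℤ) • g) := by
        rw [map_zsmul, smul_smul, smul_smul, mul_comm a₁ 2, mul_comm b₁ 2]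
      rw [he] at hy ⊢
      have hone₂ : ∀ j : ℕ, ((2 : ℤ) ^ j) • ((2 : ℤ) • g) ∈ L →
          ((2 : ℤ) ^ j) • ((2 : ℤ) • g) ∈ AddSubgroup.closure (T ∪ w '' T) := fun j hj ↦ by
        rw [smul_smul, ← pow_succ] at hj ⊢
        exact hone (j + 1) hj
      have ha₁ : (2 * a₁).natAbs = 2 * a₁.natAbs := by rw [Int.natAbs_mul]; rfl
      have hb₁ : (2 * b₁).natAbs = 2 * b₁.natAbs := by rw [Int.natAbs_mul]; rfl
      rw [ha₁, hb₁] at hab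
      have hpos : 0 < a₁.natAbs + b₁.natAbs := by
        rcases not_and_or.mp h0 with ha0 | hb0
        · exact Nat.add_pos_left (Int.natAbs_pos.mpr ha0) _
        · exact Nat.add_pos_right _ (Int.natAbs_pos.mpr hb0)
      exact ih ((2 : ℤ) • g) hone₂ a₁ b₁ (by omega) hy
    · -- not both even: the norm `N = a² − ab + b²` is odd
      have hodd : Odd (a * a - a * b + b * b) := by
        rw [← Int.not_even_iff_odd]
        rw [← even_iff_two_dvd, ← even_iff_two_dvd] at h2
        simp only [Int.even_add, Int.even_sub, Int.even_mul]
        tauto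
      -- `N • g` is locally trivial, hence so is `g`
      have hNg : (a * a - a * b + b * b) • g ∈ L := by
        rw [← conj_smul_pair_eq w hw g a b]
        exact add_mem (L.zsmul_mem hy _) (L.zsmul_mem (hL _ hy) _)
      have hcop : IsCoprime (a * a - a * b + b * b) ((2 : ℤ) ^ m) := by
        obtain ⟨k, hk⟩ := hodd
        exact (show IsCoprime (a * a - a * b + b * b) 2 from ⟨1, -k, by rw [hk]; ring⟩).pow_right
      have hg : g ∈ L := by
        obtain ⟨u, v, huv⟩ := hcop
        have e : g = u • ((a * a - a * b + b * b) • g) + v • (((2 : ℤ) ^ m) • g) := by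
          rw [smul_smul, smul_smul, ← add_smul, huv, one_smul]
        rw [e, hM' g, smul_zero, add_zero]
        exact L.zsmul_mem hNg _
      -- hence `g` is small (`hone` at `j = 0`), and so is `a • g + b • w g`
      have hg' : g ∈ AddSubgroup.closure (T ∪ w '' T) := by
        simpa using hone 0 (by simpa using hg)
      exact add_mem (AddSubgroup.zsmul_mem _ hg' _)
        (AddSubgroup.zsmul_mem _ (map_mem_closure_union_image w hw T hg') _)

/-- ★ **The (T-L3) KERNEL FORM — generic witness.**  For an abelian group `S` killed by `N ∣ 2^m`, an
additive `w` with `w (w x) + w x + x = 0`, a family of subgroups `Ker i` (`P i`) each `w`-stable, a set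
`T` inside all of them, and an element `g` such that every locally trivial `2^j • g` lies in the small
closure `closure (T ∪ w '' T)` (`hone`; see `forall_pow_smul_mem_of_pivot`): on the big closure
`closure (insert g (insert (w g) (T ∪ w '' T)))`, «locally trivial at every `i` with `P i`» is
EQUIVALENT to «small».  This is RESIDUE c v3's clause (T-L3) conclusion with `S := galH1Torsion (X_K) n`,
`w := resH1Hom (ContinuousMonoidHom.id _) fn_X hfn_X`, `ι := HeightOneSpectrum (𝓞 K)`,
`P v := (ℓ : 𝓞 K) ∈ v.asIdeal`, `Ker v := torsionLocalKer (v.adicCompletion K) n`, `T := _` (unified to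
`↑T_X`, see the module docstring), `g := g_X`, `N := 2^κ * 2^κ`, `m := κ + κ`,
`hN := zsmul_galH1Torsion_eq_zero _ _`, `hNm := dvd_of_eq (pow_add 2 κ κ).symm`.
[cite: KolyvaginEulerSystems1990, §4] [cite: McCallumLMS1991, §5, Thm. 5.4] -/
theorem kernelForm_closure_pair_iff (hw : ∀ x, w (w x) + w x + x = 0) (N m : ℕ)
    (hN : ∀ x : S, (N : ℤ) • x = 0) (hNm : N ∣ 2 ^ m) {ι : Type*} (P : ι → Prop)
    (Ker : ι → AddSubgroup S)
    (hKer : ∀ i, P i → ∀ x ∈ Ker i, w x ∈ Ker i) (T : Set S) (hT : ∀ t ∈ T, ∀ i, P i → t ∈ Ker i)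
    (g : S) (hone : ∀ j : ℕ, (∀ i, P i → ((2 : ℤ) ^ j) • g ∈ Ker i) →
      ((2 : ℤ) ^ j) • g ∈ AddSubgroup.closure (T ∪ w '' T)) :
    ∀ x ∈ AddSubgroup.closure (insert g (insert (w g) (T ∪ w '' T))),
      (∀ i, P i → x ∈ Ker i) ↔ x ∈ AddSubgroup.closure (T ∪ w '' T) := by
  -- the subgroup of everywhere-locally-trivial elements
  let L : AddSubgroup S := ⨅ i, ⨅ (_ : P i), Ker i
  have hLmem : ∀ x, x ∈ L ↔ ∀ i, P i → x ∈ Ker i := fun x ↦ by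
    simp only [L, AddSubgroup.mem_iInf]
  have hL : ∀ x ∈ L, w x ∈ L := fun x hx ↦
    (hLmem _).mpr fun i hi ↦ hKer i hi x ((hLmem x).mp hx i hi)
  have hSmL : AddSubgroup.closure (T ∪ w '' T) ≤ L := by
    rw [AddSubgroup.closure_le]
    rintro t (ht | ⟨u, hu, rfl⟩)
    · exact (hLmem t).mpr (hT t ht)
    · exact hL u ((hLmem u).mpr (hT u hu))
  intro x hx
  -- `x = a • g + b • w g + s` with `s` small
  obtain ⟨a, b, s, hs, rfl⟩ : ∃ a b : ℤ, ∃ s ∈ AddSubgroup.closure (T ∪ w '' T),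
      x = a • g + b • w g + s := by
    refine AddSubgroup.closure_induction (fun y hy ↦ ?_) ?_ (fun y z _ _ hy hz ↦ ?_)
      (fun y _ hy ↦ ?_) hx
    · rcases hy with rfl | rfl | hy
      · exact ⟨1, 0, 0, zero_mem _, by simp⟩
      · exact ⟨0, 1, 0, zero_mem _, by simp⟩
      · exact ⟨0, 0, y, AddSubgroup.subset_closure hy, by simp⟩
    · exact ⟨0, 0, 0, zero_mem _, by simp⟩
    · obtain ⟨a, b, s, hs, rfl⟩ := hy
      obtain ⟨c, d, t, ht, rfl⟩ := hz
      exact ⟨a + c, b + d, s + t, add_mem hs ht, by rw [add_smul, add_smul]; abel⟩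
    · obtain ⟨a, b, s, hs, rfl⟩ := hy
      exact ⟨-a, -b, -s, neg_mem hs, by rw [neg_smul, neg_smul]; abel⟩
  constructor
  · intro hxL
    have hy : a • g + b • w g ∈ L := by
      simpa using sub_mem ((hLmem _).mpr hxL) (hSmL hs)
    exact add_mem (pair_smul_mem_closure_of_mem w hw N m hN hNm L hL T _ g
      (fun j hj ↦ hone j ((hLmem _).mp hj)) a b le_rfl hy) hs
  · intro hxS i hi
    exact (hLmem _).mp (hSmL hxS) i hi

/-- **`hone` from ONE pivot.**  If `2^i • g` is small and (when `i ≠ 0`) the pivot `2^(i−1) • g` is NOT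
locally trivial, then every locally trivial `2^j • g` is small (`j ≥ i`: a multiple of `2^i • g`;
`j < i`: then the pivot, a multiple of `2^j • g`, would be locally trivial).  This is what the rows'
pair-Čebotarev leaf has to supply per curve: the pivot is not in `torsionLocalKer` at the prime `ℓ`.
[cite: KolyvaginEulerSystems1990, §4] -/
theorem forall_pow_smul_mem_of_pivot {ι : Type*} (P : ι → Prop) (Ker : ι → AddSubgroup S)
    (X : Set S) (g : S) (i : ℕ) (hi : ((2 : ℤ) ^ i) • g ∈ AddSubgroup.closure X)
    (hpiv : i ≠ 0 → ¬ ∀ k, P k → ((2 : ℤ) ^ (i - 1)) • g ∈ Ker k) :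
    ∀ j : ℕ, (∀ k, P k → ((2 : ℤ) ^ j) • g ∈ Ker k) → ((2 : ℤ) ^ j) • g ∈ AddSubgroup.closure X := by
  intro j hj
  by_cases hij : i ≤ j
  · rw [show ((2 : ℤ) ^ j) = (2 : ℤ) ^ (j - i) * (2 : ℤ) ^ i by
      rw [← pow_add, Nat.sub_add_cancel hij], mul_smul]
    exact AddSubgroup.zsmul_mem _ hi _
  · refine absurd (fun k hk ↦ ?_) (hpiv (by omega))
    rw [show ((2 : ℤ) ^ (i - 1)) = (2 : ℤ) ^ (i - 1 - j) * (2 : ℤ) ^ j by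
      rw [← pow_add]; congr 1; omega, mul_smul]
    exact AddSubgroup.zsmul_mem _ (hj k hk) _

end KernelForm

end Summit.BirchSwinnertonDyer.BirchSwinnertonDyer.Theorems.SylvesterTwoCoupledTelescope
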